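import Summits.NavierStokesRegularity.FluidComputer.PalasekTowerEpisodes

/-!
# Re-forcing a schedule: what a schedule-universal induction step asserts about the force's future

Cell `ns-blowup`, seat `ns-blowup-ecbridge-1` (g2); companion of `PalasekTowerEpisodes.lean`
(p404510). LABEL: E-C typing (a STRUCTURAL finding about candidate route items, in kernel form);
WHAT THIS IS NOT: not Navier–Stokes evidence; no stage, tower or instance is constructed or claimed.

Context (memo `run/shared/lean/pub/ns-blowup/ecbridge/EC-BRIDGE-v2.md` §1, STATUS «FINDING
force-insensitivity»). A heredity item of the shape
`H(𝒞, m) := ∀ S, 𝒞 S → ∀ k ≥ 1, ∀ s : Stage ν R S m k, ∃ s' : Stage ν R S m (k+1), s.Extends s'`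
(the refuted `EpisodeInduction` is `𝒞 = ⊤`; the re-pin `EpisodeInductionPinned` of
`PalasekTowerEpisodesPinned.lean` is `𝒞 = (·.Pins Λ θ)`, `m = withStrain m₀`) quantifies over a
CLASS of schedules. This file proves, for any `𝒞` and `m`:

* §1 `Schedule.reforce` — replacing the force of a schedule by another ADMISSIBLE force `g` (Clay
  class, silent from `T`, `push_small`) is again a schedule with the same times, constants, ball,
  datum, loops; `Stage.reforce` — a stage of `S` at level `k` IS a stage of the re-forced schedule
  whenever `g = S.f` on the slab `[0, τ k] × ℝ³` (every stage clause lives on the slab) and the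
  margin holds there.
* §2 `Schedule.silenced a b` — the force `χ(t) • S.f t x` with a smooth cut-off `χ = 1` on
  `(-∞, a]`, `χ = 0` on `[b, ∞)` (`a < b`); it is admissible as soon as `S.f` is CONFINED to the ball
  (the re-pin's `force_confined`): Clay smoothness by products, Fefferman's decay (5) from compact
  support inside the half-space (the argument of `PalasekTowerForceBudget.clayForce_of_summable_levels`,
  within-derivative version), silence and `push_small` inherited (`0 ≤ χ ≤ 1`). `Schedule.silence b`
  = the schedule re-forced by `silenced (τ 1) b`.
* §3 THE FINDING `coherentChain_silent_of_classInduction`: if `H(𝒞, m)` holds, `S` carries a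
  stage `s₁` at level `1`, the silenced schedule `S.silence b` (force ≡ 0 from any `b > τ 1` on) is
  still in `𝒞`, and the margin of `s₁` transfers, then `S.silence b` carries a COHERENT INFINITE CHAIN
  of stages — by `Realisation.ofEpisodes`, a realisation of the tower whose force is SILENT from
  `b` on (`realisation_silent_of_classInduction`): an AUTONOMOUS cascade to blow-up from the smooth
  finite-energy state at time `b`. For the re-pin both side conditions hold (pins do not read the
  force beyond confinement and `push_small`; `⊤`, persistence and the strain floor do not read it at
  all), so `EpisodeBasePinned ∧ EpisodeInductionPinned` assert the SILENT-TAIL variant that the route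
  brief separates from the E–C claim as different and harder — whereas in Palasek's model the force
  is NECESSARY for blow-up (Rem. 1.4). A heredity item for a FORCED tower must therefore pin the
  force's future (a design class), or the split must avoid the universal quantifier
  (`PalasekTowerDepth.lean`). Instantiation by name for the re-pin: companion file, once its olean
  is built.

References: S. Palasek, arXiv:2605.13827 §4 and Rem. 1.4 [cite: Palasek2026ElementaryModel, §4];
C. L. Fefferman, Clay problem description, (5) [cite: FeffermanClay2006, (5)].
-/

noncomputable section

namespace Summit.NavierStokesRegularity.FluidComputer.PalasekTowerClayBridge

open Set MeasureTheory Filter Topology Function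
open scoped ENNReal ContDiff NNReal
open Literature.Analysis.FluidPDE

/-! ## §1 Re-forcing a schedule and transporting a stage -/

namespace Schedule

variable {R : TowerRates} (S : Schedule R)

/-- **Re-forcing**: the schedule `S` with its force replaced by an admissible `g` (Clay class,
silent from `T`, host-floor-small on the growth intervals); every other field is kept. [folklore] -/
def reforce (g : ℝ → EuclideanSpace ℝ (Fin 3) → EuclideanSpace ℝ (Fin 3))
    (h₁ : IsSmoothOnHalfSpace g) (h₂ : HasRapidSpaceTimeDecay g)
    (h₃ : ∀ t, S.T ≤ t → ∀ x, g t x = 0)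
    (h₄ : ∀ k, ∀ t ∈ Icc (S.τ k) (S.τ (k + 1)), ∀ x, ‖g t x‖ ≤ S.c₄ * R.Y k) : Schedule R :=
  { S with f := g, force_smooth := h₁, force_decay := h₂, force_silent := h₃, push_small := h₄ }

variable {S}
variable {g : ℝ → EuclideanSpace ℝ (Fin 3) → EuclideanSpace ℝ (Fin 3)}
  {h₁ : IsSmoothOnHalfSpace g} {h₂ : HasRapidSpaceTimeDecay g}
  {h₃ : ∀ t, S.T ≤ t → ∀ x, g t x = 0}
  {h₄ : ∀ k, ∀ t ∈ Icc (S.τ k) (S.τ (k + 1)), ∀ x, ‖g t x‖ ≤ S.c₄ * R.Y k}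

/-- The re-forced schedule carries the new force. [folklore] -/
@[simp] theorem reforce_f : (S.reforce g h₁ h₂ h₃ h₄).f = g := rfl

/-- Re-forcing keeps the readout times. [folklore] -/
@[simp] theorem reforce_τ : (S.reforce g h₁ h₂ h₃ h₄).τ = S.τ := rfl

/-- Re-forcing keeps the blow-up time. [folklore] -/
@[simp] theorem reforce_T : (S.reforce g h₁ h₂ h₃ h₄).T = S.T := rfl

/-- Re-forcing keeps the datum. [folklore] -/
@[simp] theorem reforce_u₀ : (S.reforce g h₁ h₂ h₃ h₄).u₀ = S.u₀ := rfl

/-- Re-forcing keeps the ball. [folklore] -/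
@[simp] theorem reforce_radius : (S.reforce g h₁ h₂ h₃ h₄).radius = S.radius := rfl

/-- Re-forcing keeps the floor constant. [folklore] -/
@[simp] theorem reforce_c₁ : (S.reforce g h₁ h₂ h₃ h₄).c₁ = S.c₁ := rfl

/-- Re-forcing keeps the ceiling constant. [folklore] -/
@[simp] theorem reforce_c₂ : (S.reforce g h₁ h₂ h₃ h₄).c₂ = S.c₂ := rfl

/-- Re-forcing keeps the clock constant. [folklore] -/
@[simp] theorem reforce_c₃ : (S.reforce g h₁ h₂ h₃ h₄).c₃ = S.c₃ := rfl

/-- Re-forcing keeps the push constant. [folklore] -/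
@[simp] theorem reforce_c₄ : (S.reforce g h₁ h₂ h₃ h₄).c₄ = S.c₄ := rfl

/-- Re-forcing keeps the window constant. [folklore] -/
@[simp] theorem reforce_c₅ : (S.reforce g h₁ h₂ h₃ h₄).c₅ = S.c₅ := rfl

end Schedule

/-- **Transport of a stage to the re-forced schedule.** A stage of `S` at level `k` is a stage of
`S.reforce g …` at level `k` as soon as `g = S.f` on the slab `[0, τ k] × ℝ³` and the margin holds
for the re-forced schedule: every clause of `Stage` lives on the slab. [folklore] -/
def Stage.reforce {ν : ℝ} {R : TowerRates} {S : Schedule R} {m : Margins R} {k : ℕ}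
    (s : Stage ν R S m k) (g : ℝ → EuclideanSpace ℝ (Fin 3) → EuclideanSpace ℝ (Fin 3))
    (h₁ : IsSmoothOnHalfSpace g) (h₂ : HasRapidSpaceTimeDecay g)
    (h₃ : ∀ t, S.T ≤ t → ∀ x, g t x = 0)
    (h₄ : ∀ k, ∀ t ∈ Icc (S.τ k) (S.τ (k + 1)), ∀ x, ‖g t x‖ ≤ S.c₄ * R.Y k)
    (hg : ∀ t ∈ Icc 0 (S.τ k), ∀ x, g t x = S.f t x)
    (hm : m (S.reforce g h₁ h₂ h₃ h₄) k s.u) : Stage ν R (S.reforce g h₁ h₂ h₃ h₄) m k where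
  u := s.u
  p := s.p
  classical := by
    refine ⟨s.classical.smooth_velocity, s.classical.smooth_pressure, ?_, s.classical.divFree⟩
    intro t ht x
    have hmom := s.classical.momentum t ht x
    simp only [Schedule.reforce_f]
    rw [hg t ht x]
    exact hmom
  initial := s.initial
  energy := s.energy
  floor := s.floor
  ceiling := s.ceiling
  quiet := s.quiet
  margin := hm

/-! ## §2 The silenced force: a smooth time cut-off of a confined Clay force -/

/-- A smooth cut-off in time: `= 1` on `(-∞, a]`, `= 0` on `[b, ∞)` (for `a < b`), values in
`[0, 1]` (Mathlib `Real.smoothTransition`). [folklore] -/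
def cutoff (a b t : ℝ) : ℝ := Real.smoothTransition ((b - t) / (b - a))

namespace cutoff

variable {a b t : ℝ}

/-- The cut-off is `1` up to `a`. [folklore] -/
theorem eq_one (hab : a < b) (ht : t ≤ a) : cutoff a b t = 1 := by
  unfold cutoff
  apply Real.smoothTransition.one_of_one_le
  rw [le_div_iff₀ (by linarith)]
  linarith

/-- The cut-off is `0` from `b` on. [folklore] -/
theorem eq_zero (hab : a < b) (ht : b ≤ t) : cutoff a b t = 0 := by
  unfold cutoff
  apply Real.smoothTransition.zero_of_nonpos
  exact div_nonpos_of_nonpos_of_nonneg (by linarith) (by linarith)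

/-- The cut-off is nonnegative. [folklore] -/
theorem nonneg : 0 ≤ cutoff a b t := Real.smoothTransition.nonneg _

/-- The cut-off is at most `1`. [folklore] -/
theorem le_one : cutoff a b t ≤ 1 := Real.smoothTransition.le_one _

/-- The cut-off is smooth in `t`. [folklore] -/
theorem contDiff (a b : ℝ) : ContDiff ℝ ∞ (cutoff a b) := by
  unfold cutoff
  exact Real.smoothTransition.contDiff.comp ((contDiff_const.sub contDiff_id).div_const _)

end cutoff

namespace Schedule

variable {R : TowerRates} (S : Schedule R)

/-- **The silenced force**: `S.f` multiplied by the time cut-off `cutoff a b` — equal to `S.f` up to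
time `a`, identically `0` from time `b` on. [folklore] -/
def silenced (a b : ℝ) : ℝ → EuclideanSpace ℝ (Fin 3) → EuclideanSpace ℝ (Fin 3) :=
  fun t x => cutoff a b t • S.f t x

variable {S} {a b : ℝ}

/-- The silenced force agrees with `S.f` up to time `a`. [folklore] -/
theorem silenced_eq_of_le (hab : a < b) {t : ℝ} (ht : t ≤ a) (x : EuclideanSpace ℝ (Fin 3)) :
    S.silenced a b t x = S.f t x := by
  simp [silenced, cutoff.eq_one hab ht]

/-- The silenced force vanishes from time `b` on. [folklore] -/
theorem silenced_eq_zero_of_le (hab : a < b) {t : ℝ} (ht : b ≤ t) (x : EuclideanSpace ℝ (Fin 3)) :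
    S.silenced a b t x = 0 := by
  simp [silenced, cutoff.eq_zero hab ht]

/-- The silenced force is pointwise no larger than `S.f`. [folklore] -/
theorem norm_silenced_le (t : ℝ) (x : EuclideanSpace ℝ (Fin 3)) :
    ‖S.silenced a b t x‖ ≤ ‖S.f t x‖ := by
  simp only [silenced, norm_smul, Real.norm_eq_abs, abs_of_nonneg cutoff.nonneg]
  exact mul_le_of_le_one_left (norm_nonneg _) cutoff.le_one

/-- The silenced force is silent wherever `S.f` is: from `S.T` on. [folklore] -/
theorem silenced_silent : ∀ t, S.T ≤ t → ∀ x, S.silenced a b t x = 0 := by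
  intro t ht x
  simp [silenced, S.force_silent t ht x]

/-- The silenced force obeys `push_small`. [folklore] -/
theorem silenced_push_small :
    ∀ k, ∀ t ∈ Icc (S.τ k) (S.τ (k + 1)), ∀ x, ‖S.silenced a b t x‖ ≤ S.c₄ * R.Y k :=
  fun k t ht x => (norm_silenced_le t x).trans (S.push_small k t ht x)

/-- The silenced force is confined to the ball if `S.f` is. [folklore] -/
theorem silenced_confined (hconf : ∀ t x, S.radius < ‖x‖ → S.f t x = 0) :
    ∀ t x, S.radius < ‖x‖ → S.silenced a b t x = 0 := by
  intro t x hx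
  simp [silenced, hconf t x hx]

/-- The silenced force is smooth on the closed half-space (product of smooth functions). [folklore] -/
theorem silenced_smooth : IsSmoothOnHalfSpace (S.silenced a b) := by
  have hχ : ContDiffOn ℝ ∞ (fun z : ℝ × EuclideanSpace ℝ (Fin 3) => cutoff a b z.1)
      (Ici (0 : ℝ) ×ˢ univ) :=
    ((cutoff.contDiff a b).comp contDiff_fst).contDiffOn
  have h : ContDiffOn ℝ ∞ (fun z : ℝ × EuclideanSpace ℝ (Fin 3) => cutoff a b z.1 • uncurry S.f z)
      (Ici (0 : ℝ) ×ˢ univ) := hχ.smul S.force_smooth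
  exact h

/-- **Fefferman's decay (5) for the silenced force of a CONFINED schedule**: the silenced force
vanishes for `t ≥ T` and for `‖x‖ > radius`, so on the closed half-space it is supported in the
compact box `[0, T] × B̄(0, radius)`, where every within-derivative is bounded (continuity of
`iteratedFDerivWithin` on the half-space); outside the box the within-derivatives vanish (the force
is zero on a relative neighbourhood). [cite: FeffermanClay2006, (5)] -/
theorem silenced_decay (hconf : ∀ t x, S.radius < ‖x‖ → S.f t x = 0) :
    HasRapidSpaceTimeDecay (S.silenced a b) := by
  intro n K
  set H : Set (ℝ × EuclideanSpace ℝ (Fin 3)) := Ici (0 : ℝ) ×ˢ univ with hHdef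
  set G : ℝ × EuclideanSpace ℝ (Fin 3) → EuclideanSpace ℝ (Fin 3) := uncurry (S.silenced a b)
    with hGdef
  have hUD : UniqueDiffOn ℝ H := (uniqueDiffOn_Ici 0).prod uniqueDiffOn_univ
  have hG : ContDiffOn ℝ ∞ G H := S.silenced_smooth
  -- continuity of the weighted within-derivative on the half-space
  have hcont : ContinuousOn (fun z => iteratedFDerivWithin ℝ n G H z) H :=
    hG.continuousOn_iteratedFDerivWithin (m := n) (by exact_mod_cast le_top) hUD
  set Φ : ℝ × EuclideanSpace ℝ (Fin 3) → ℝ :=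
    fun z => (1 + ‖z.2‖ + z.1) ^ K * ‖iteratedFDerivWithin ℝ n G H z‖ with hΦdef
  have hw : Continuous fun z : ℝ × EuclideanSpace ℝ (Fin 3) => (1 + ‖z.2‖ + z.1) ^ K :=
    ((continuous_const.add continuous_snd.norm).add continuous_fst).pow K
  have hΦc : ContinuousOn Φ H := hw.continuousOn.mul hcont.norm
  -- the compact box inside the half-space
  set B : Set (ℝ × EuclideanSpace ℝ (Fin 3)) :=
    Icc (0 : ℝ) S.T ×ˢ Metric.closedBall (0 : EuclideanSpace ℝ (Fin 3)) S.radius with hBdef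
  have hBc : IsCompact B := isCompact_Icc.prod (isCompact_closedBall _ _)
  have hBH : B ⊆ H := prod_mono (fun t ht => ht.1) (subset_univ _)
  obtain ⟨C, hC⟩ := hBc.exists_bound_of_continuousOn (hΦc.mono hBH)
  refine ⟨max C 0, fun t ht x => ?_⟩
  have hz : ((t, x) : ℝ × EuclideanSpace ℝ (Fin 3)) ∈ H := mk_mem_prod ht (mem_univ _)
  by_cases hmem : ((t, x) : ℝ × EuclideanSpace ℝ (Fin 3)) ∈ B
  · have h1 := hC _ hmem
    simp only [hΦdef, Real.norm_eq_abs] at h1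
    exact le_trans (le_trans (le_abs_self _) h1) (le_max_left _ _)
  · -- outside the box the force vanishes near `(t, x)`, hence so does the within-derivative
    have hvan : G =ᶠ[𝓝[H] (t, x)] fun _ => 0 := by
      have hx0 : 0 ≤ t := ht
      -- either `t > T` or `‖x‖ > radius`
      have hcase : S.T < t ∨ S.radius < ‖x‖ := by
        by_contra hcon
        push Not at hcon
        apply hmem
        refine mk_mem_prod ⟨hx0, hcon.1⟩ ?_
        rw [Metric.mem_closedBall, dist_zero_right]
        exact hcon.2
      rcases hcase with hT | hX
      · have hopen : IsOpen {w : ℝ × EuclideanSpace ℝ (Fin 3) | S.T < w.1} :=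
          isOpen_lt continuous_const continuous_fst
        have hmemw : ((t, x) : ℝ × EuclideanSpace ℝ (Fin 3)) ∈ {w | S.T < w.1} := hT
        filter_upwards [mem_nhdsWithin_of_mem_nhds (hopen.mem_nhds hmemw)] with w hw
        simp only [hGdef, uncurry]
        exact S.silenced_silent w.1 (le_of_lt hw) w.2
      · have hopen : IsOpen {w : ℝ × EuclideanSpace ℝ (Fin 3) | S.radius < ‖w.2‖} :=
          isOpen_lt continuous_const continuous_snd.norm
        have hmemw : ((t, x) : ℝ × EuclideanSpace ℝ (Fin 3)) ∈ {w | S.radius < ‖w.2‖} := hX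
        filter_upwards [mem_nhdsWithin_of_mem_nhds (hopen.mem_nhds hmemw)] with w hw
        simp only [hGdef, uncurry]
        exact S.silenced_confined hconf w.1 w.2 hw
    have hzero : iteratedFDerivWithin ℝ n G H (t, x) = 0 := by
      rw [hvan.iteratedFDerivWithin_eq (hvan.self_of_nhdsWithin hz) n]
      exact congrFun iteratedFDerivWithin_fun_zero _
    rw [show iteratedFDerivWithin ℝ n (uncurry (S.silenced a b)) (Ici (0 : ℝ) ×ˢ univ) (t, x) =
      iteratedFDerivWithin ℝ n G H (t, x) from rfl, hzero, norm_zero, mul_zero]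
    exact le_max_right _ _

/-- **The silenced schedule**: `S` re-forced by its own force cut off after `τ 1` (silent from `b`
on, `τ 1 < b`); a schedule as soon as `S.f` is confined to the ball. [folklore] -/
def silence (b : ℝ) (hconf : ∀ t x, S.radius < ‖x‖ → S.f t x = 0) : Schedule R :=
  S.reforce (S.silenced (S.τ 1) b) S.silenced_smooth (S.silenced_decay hconf) S.silenced_silent
    S.silenced_push_small

/-- The silenced schedule's force vanishes from `b` on. [folklore] -/
theorem silence_silent {hconf : ∀ t x, S.radius < ‖x‖ → S.f t x = 0} (hb : S.τ 1 < b) :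
    ∀ t, b ≤ t → ∀ x, (S.silence b hconf).f t x = 0 :=
  fun _ ht x => silenced_eq_zero_of_le hb ht x

/-- The silenced schedule's force is confined to the ball. [folklore] -/
theorem silence_confined {hconf : ∀ t x, S.radius < ‖x‖ → S.f t x = 0} :
    ∀ t x, (S.silence b hconf).radius < ‖x‖ → (S.silence b hconf).f t x = 0 :=
  fun t x hx => silenced_confined hconf t x hx

/-- The silenced schedule keeps datum, times and constants. [folklore] -/
theorem silence_data {hconf : ∀ t x, S.radius < ‖x‖ → S.f t x = 0} :
    (S.silence b hconf).u₀ = S.u₀ ∧ (S.silence b hconf).T = S.T ∧ (S.silence b hconf).τ = S.τ ∧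
      (S.silence b hconf).radius = S.radius ∧ (S.silence b hconf).c₁ = S.c₁ ∧
      (S.silence b hconf).c₂ = S.c₂ ∧ (S.silence b hconf).c₄ = S.c₄ :=
  ⟨rfl, rfl, rfl, rfl, rfl, rfl, rfl⟩

end Schedule

/-- A level-`1` stage of `S` is a level-`1` stage of the silenced schedule (the forces agree on
`[0, τ 1]`), given the margin there. [folklore] -/
def Stage.silence {ν : ℝ} {R : TowerRates} {S : Schedule R} {m : Margins R} (s₁ : Stage ν R S m 1)
    {b : ℝ} (hb : S.τ 1 < b) (hconf : ∀ t x, S.radius < ‖x‖ → S.f t x = 0)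
    (hm : m (S.silence b hconf) 1 s₁.u) : Stage ν R (S.silence b hconf) m 1 :=
  s₁.reforce _ _ _ _ _ (fun _ ht x => Schedule.silenced_eq_of_le hb ht.2 x) hm

/-! ## §3 The finding: class-universal heredity asserts the silent tail -/

open Assembly in
/-- **What a schedule-universal induction step asserts about the force's future.** Let
`H(𝒞, m)` be heredity over the class `𝒞` (every stage at every level `≥ 1` of every schedule in
`𝒞` extends by one level). If `S` has a stage `s₁` at level `1`, its force is confined to the ball,
the SILENCED schedule (same datum, times, constants; force cut off smoothly after `τ 1`, identically
zero from `b` on) is still in `𝒞`, and `s₁`'s margin transfers to it, then the silenced schedule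
carries a coherent infinite chain of stages — every later level grows with NO force at all. (For
the re-pin `𝒞 = (·.Pins Λ θ)`, `m = withStrain m₀` with `m₀ ∈ {⊤, persistence}`, both side
conditions hold: companion file.) [folklore] -/
theorem coherentChain_silent_of_classInduction {ν : ℝ} {R : TowerRates} {𝒞 : Schedule R → Prop}
    {m : Margins R}
    (h : ∀ S : Schedule R, 𝒞 S → ∀ k : ℕ, 1 ≤ k → ∀ s : Stage ν R S m k,
      ∃ s' : Stage ν R S m (k + 1), s.Extends s')
    {S : Schedule R} (s₁ : Stage ν R S m 1) (hconf : ∀ t x, S.radius < ‖x‖ → S.f t x = 0)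
    {b : ℝ} (hb : S.τ 1 < b) (h𝒞 : 𝒞 (S.silence b hconf)) (hm : m (S.silence b hconf) 1 s₁.u) :
    ∃ S' : Schedule R, (∀ t, b ≤ t → ∀ x, S'.f t x = 0) ∧ S'.u₀ = S.u₀ ∧ S'.T = S.T ∧ S'.τ = S.τ ∧
      ∃ st : (n : ℕ) → Stage ν R S' m (n + 1), ∀ n, (st n).Extends (st (n + 1)) := by
  have step : ∀ n, ∀ s : Stage ν R (S.silence b hconf) m (n + 1),
      ∃ s' : Stage ν R (S.silence b hconf) m (n + 1 + 1), s.Extends s' :=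
    fun n s => h _ h𝒞 (n + 1) (Nat.succ_pos n) s
  exact ⟨S.silence b hconf, Schedule.silence_silent (hconf := hconf) hb, rfl, rfl, rfl,
    chain (s₁.silence hb hconf hm) step, chain_extends (s₁.silence hb hconf hm) step⟩

/-- **… hence a realisation of the tower whose force is SILENT from `b` on** — an autonomous
cascade to blow-up from the smooth finite-energy state at time `b` (any `b ∈ (τ 1, T)`), by the
landed gluing `Realisation.ofEpisodes`. This is the silent-tail variant, which the route brief
separates from the E–C claim; in Palasek's model the force is necessary for blow-up (Rem. 1.4).
[cite: Palasek2026ElementaryModel, §4] -/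
theorem realisation_silent_of_classInduction {ν : ℝ} {R : TowerRates} {𝒞 : Schedule R → Prop}
    {m : Margins R}
    (h : ∀ S : Schedule R, 𝒞 S → ∀ k : ℕ, 1 ≤ k → ∀ s : Stage ν R S m k,
      ∃ s' : Stage ν R S m (k + 1), s.Extends s')
    {S : Schedule R} (s₁ : Stage ν R S m 1) (hconf : ∀ t x, S.radius < ‖x‖ → S.f t x = 0)
    {b : ℝ} (hb : S.τ 1 < b) (h𝒞 : 𝒞 (S.silence b hconf)) (hm : m (S.silence b hconf) 1 s₁.u) :
    ∃ W : Realisation ν R, (∀ t, b ≤ t → ∀ x, W.f t x = 0) ∧ W.T = S.T := by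
  have step : ∀ n, ∀ s : Stage ν R (S.silence b hconf) m (n + 1),
      ∃ s' : Stage ν R (S.silence b hconf) m (n + 1 + 1), s.Extends s' :=
    fun n s => h _ h𝒞 (n + 1) (Nat.succ_pos n) s
  refine ⟨Realisation.ofEpisodes (S.silence b hconf) (s₁.silence hb hconf hm) step, ?_, ?_⟩
  · exact Schedule.silence_silent (hconf := hconf) hb
  · rfl

end Summit.NavierStokesRegularity.FluidComputer.PalasekTowerClayBridge

end
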